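import Summits.HodgeConjecture.HodgeConjecture.Theorems.MarkmanPartnerTransportPicardThreeK3SquaresKugaSatakeSimilitude
import Summits.HodgeConjecture.HodgeConjecture.Theorems.MarkmanPartnerTransportPicardThreeK3SquaresOneCycleThird

/-!
# Route MarkmanPartnerTransport · crux `PicardThreeK3Squares` (stmt-HodgeConjecture-19652) —
# the crux BY NAME modulo Kuga–Satake on the real-QUADRATIC RM surfaces: the residue is RM of degree ≥ 3

`…KugaSatakeSimilitude` (this seat, gen 9) proves HC⁴(S × S) for every marked projective K3 surface whose
algebra of transcendental Hodge endomorphisms is `ℚ + ℚψ` for a cup-self-adjoint `ψ` with `ψ² = d ≠ 0`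
on `T(S)` (real-QUADRATIC `E(S)`), GRANTED the Kuga–Satake statement for `S`
(`IsKSCorrespondenceAlgebraicBetti`) and modulo Varesco's Thm. 5.3
(`Varesco2023_transcendentalHodgeSimilitude_algebraic_of_kugaSatake_K3`). This file folds that sector into
the crux's reductions:

* `hodgeConjectureFor_square_of_quadraticGenerator_of_kugaSatake` — the packaged per-surface statement:
  `QuadGen[S]` (∃ such `ψ`, `d`) + Kuga–Satake for `S` ⇒ HC⁴(S × S).
* `picardThreeK3Squares_of_kugaSatake_of_oneCycle_off_quadratic` — **`PicardThreeK3Squares` BY NAME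
  from: Buskin's Thm. 1.1, markings, Varesco's Thm. 5.3, the Kuga–Satake statement for the non-CM
  projective K3 surfaces with `3 ≤ ρ(S) ≤ 16` and real-quadratic generator, and the one-cycle clause
  (`OneCycleOfDegree`, gen 8) ONLY on the non-CM, non-scalar surfaces with `3 ≤ ρ(S) ≤ 16` WITHOUT a
  real-quadratic generator** — i.e. modulo Kuga–Satake the open core of the crux is real multiplication
  of degree `[E(S):ℚ] ≥ 3` (cubic at `ρ ∈ {4, 7, 10, 13}`, quartic at `ρ ∈ {6, 10}`, quintic at `ρ = 7`,
  sextic at `ρ = 4}`; van Geemen: `[E:ℚ] · m = 22 − ρ`, `m ≥ 3`).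
* `picardThreeK3Squares_of_kugaSatake_of_realMultiplicationThird_off_quadratic` — the same with the
  cycle-induced SECTOR CLAUSE (Varesco's normal form, as in `CMThird.picardThreeK3Squares_of_realMultiplicationThird`)
  in place of the one-cycle clause, at every `ρ(S) ≥ 3`.

CONDITIONAL: the Kuga–Satake statement is OPEN in print for a general K3 surface (Varesco 2023 §5; known on
Floccari's families); nothing here says HC or the crux is proved; no definition, no sorry, no new named
fact. Prover seat hodge-nonav-19652-p1 (gen 9), `--supports stmt-HodgeConjecture-19652`.

References: M. Varesco, Math. Z. 305 (2023) art. 69, Thm. 5.3, Cor. 4.6, Conj. 4.2; van Geemen–Schütt,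
Forum Math. Sigma 13 (2025) e2, §2.1, §4.8, Rem. 4.9; B. van Geemen, Michigan Math. J. 56 (2008) Lemma 3.2;
N. Buskin, J. reine angew. Math. 755 (2019) Thm. 1.1; Yu. G. Zarhin, J. reine angew. Math. 341 (1983) Thm. 1.5.1.
-/

set_option linter.dupNamespace false

noncomputable section

namespace Summit.HodgeConjecture.HodgeConjecture.Theorems.MarkmanPartnerTransport.KugaSatakeSimilitude

open Module CategoryTheory MonoidalCategory CartesianMonoidalCategory Polynomial
open Literature.AlgebraicGeometry Literature.AlgebraicGeometry.Motives Literature.AlgebraicGeometry.HodgeTheory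
open Literature.AlgebraicGeometry.Hyperkaehler Literature.AlgebraicGeometry.Surfaces
open Literature.AlgebraicTopology.SingularHomology
open Summit.HodgeConjecture.HodgeConjecture.Theorems
open Summit.HodgeConjecture.HodgeConjecture.Theorems.MarkmanPartnerTransport
open Summit.HodgeConjecture.HodgeConjecture.Theorems.NikulinTwinTransport
open Summit.HodgeConjecture.HodgeConjecture.Theses.MarkmanPartnerTransport

variable {S : SchemeOver ℂ} {η : complexBetti S (2 * 1) ≃ₗ[ℂ] (K3Index → ℂ)} {p : complexBetti S (2 * 2)}
  {x : K3Index → ℂ}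

/-- `MarkedK3[S, η, p, x]`: VERBATIM the `let MarkedK3 := …` binder of the route declaration
`PicardThreeK3Squares`. Local notation only. -/
local notation3 (prettyPrint := false) "MarkedK3[" S ", " η ", " p ", " x "]" =>
  (p ≠ 0 ∧ (IsIntegralClass p ∧
    (∀ q : complexBetti S (2 * 2), IsIntegralClass q → ∃ n : ℤ, q = n • p) ∧
    (∀ c : complexBetti S (2 * 1), IsIntegralClass c ↔ ∃ v : K3Index → ℤ, η c = fun i => (v i : ℂ)) ∧
    (∀ a b : complexBetti S (2 * 1),
      cupProduct (rfl : 2 * 1 + 2 * 1 = 2 * 2) a b = k3Form (η a) (η b) • p) ∧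
    IsOfHodgeType 2 S (2 * 1) 2 0 (LinearEquiv.symm η x) ∧
    (∀ τ : complexBetti S (2 * 1), IsOfHodgeType 2 S (2 * 1) 2 0 τ →
      ∃ t : ℂ, τ = t • LinearEquiv.symm η x)) ∧
    (k3Form x x = 0 ∧ 0 < (k3Form (star x) x).re ∧
      ∃ u : K3Index → ℤ, k3Form (fun i => (u i : ℂ)) x = 0 ∧ 0 < ∑ i, ∑ j, u i * k3Gram i j * u j))

/-- `Corr[μ, hS ; γ, y] = fst_*(snd^* y ∪ γ)` on `H²(S(ℂ); ℂ)`. Local notation only. -/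
local notation3 (prettyPrint := false) "Corr[" μ ", " hS " ; " γ ", " y "]" =>
  complexGysin μ (IsSmoothProjective.tensor_holds hS hS) hS
    (SemiCartesianMonoidalCategory.fst _ _) (rfl : 2 * 1 + 2 * 2 + 2 * 2 = 2 * 1 + 2 * (2 + 2))
    (cupProduct (rfl : 2 * 1 + 2 * 2 = 2 * 1 + 2 * 2)
      (complexBetti.map (SemiCartesianMonoidalCategory.snd _ _) (2 * 1) y) γ)

/-- `Transc[S, y]`: `y` is cup-orthogonal to `N¹(S)`. Local notation only. -/
local notation3 (prettyPrint := false) "Transc[" S ", " y "]" =>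
  (∀ d ∈ algebraicClasses S 1, cupProduct (rfl : 2 * 1 + 2 * 1 = 2 * 2) y d = 0)

/-- `Scalar[S]`: «`End_Hdg T(S) = ℚ`» (VERBATIM the clause of `HighPicard` / `…OneCycleThird`). Local notation only. -/
local notation3 (prettyPrint := false) "Scalar[" S "]" =>
  (∀ (f : complexBetti S (2 * 1) →ₗ[ℂ] complexBetti S (2 * 1)),
    (∀ y, IsRationalClass y → IsRationalClass (f y)) →
    (∀ (i j : ℕ) y, IsOfHodgeType 2 S (2 * 1) i j y → IsOfHodgeType 2 S (2 * 1) i j (f y)) →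
    (∀ d ∈ algebraicClasses S 1, f d = 0) →
    (∀ y : complexBetti S (2 * 1), ∀ d ∈ algebraicClasses S 1,
      cupProduct (rfl : 2 * 1 + 2 * 1 = 2 * 2) (f y) d = 0) →
    ∃ a : ℚ, ∀ y : complexBetti S (2 * 1),
      (∀ d ∈ algebraicClasses S 1, cupProduct (rfl : 2 * 1 + 2 * 1 = 2 * 2) y d = 0) →
        f y = (a : ℂ) • y)

/-- `QuadGen[S]`: «`End_Hdg T(S)` has a REAL-QUADRATIC GENERATOR» — some `ψ ∈ End H²(S(ℂ); ℂ)` rational,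
Hodge-type preserving, killing `N¹(S)`, with image cup-orthogonal to `N¹(S)`, cup-self-adjoint, with
`ψ² = d` on `T(S)` for a rational `d ≠ 0`, GENERATES the transcendental Hodge endomorphisms
(`End_Hdg T(S) = ℚ[ψ|_T] = ℚ + ℚψ`): exactly the data of
`hodgeConjectureFor_square_of_selfSimilitude_generator_of_kugaSatake`. For `d` a non-square this is
«`E(S) = ℚ(√d)`, real quadratic RM». Local notation only. -/
local notation3 (prettyPrint := false) "QuadGen[" S "]" =>
  (∃ (ψ : complexBetti S (2 * 1) →ₗ[ℂ] complexBetti S (2 * 1)) (d : ℚ), d ≠ 0 ∧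
    (∀ y, IsRationalClass y → IsRationalClass (ψ y)) ∧
    (∀ (i j : ℕ) y, IsOfHodgeType 2 S (2 * 1) i j y → IsOfHodgeType 2 S (2 * 1) i j (ψ y)) ∧
    (∀ d' ∈ algebraicClasses S 1, ψ d' = 0) ∧
    (∀ y : complexBetti S (2 * 1), Transc[S, ψ y]) ∧
    (∀ y w : complexBetti S (2 * 1),
      cupProduct (rfl : 2 * 1 + 2 * 1 = 2 * 2) (ψ y) w = cupProduct (rfl : 2 * 1 + 2 * 1 = 2 * 2) y (ψ w)) ∧
    (∀ y : complexBetti S (2 * 1), Transc[S, y] → ψ (ψ y) = (d : ℂ) • y) ∧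
    TranscendentalEndomorphismsGeneratedBy S ψ)

/-- `OneCycleOfDegree[S, hS]` (VERBATIM the clause of `…OneCycleThird`): ONE cycle-induced rational Hodge
endomorphism whose `(2,0)`-eigenvalue has minimal polynomial of admissible degree. Local notation only. -/
local notation3 (prettyPrint := false) "OneCycleOfDegree[" S ", " hS "]" =>
  (∃ (k : ℕ) (e : complexBetti S (2 * 1) →ₗ[ℂ] complexBetti S (2 * 1)),
    (∀ j m : ℕ, 2 ≤ j → 3 ≤ m → k * j * m + Module.finrank ℂ ↥(algebraicClasses S 1) ≠ 22) ∧
    (∀ y, IsRationalClass y → IsRationalClass (e y)) ∧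
    (∀ (i j : ℕ) y, IsOfHodgeType 2 S (2 * 1) i j y → IsOfHodgeType 2 S (2 * 1) i j (e y)) ∧
    (∃ γ ∈ algebraicClasses (S ⊗ S) 2, ∀ y : complexBetti S (2 * 1),
      e y = Corr[complexOrientationFamily, IsK3Surface.isSmoothProjective hS ; γ, y]) ∧
    (∃ (σ₀ : complexBetti S (2 * 1)) (ev : ℂ), IsOfHodgeType 2 S (2 * 1) 2 0 σ₀ ∧ σ₀ ≠ 0 ∧
      e σ₀ = ev • σ₀ ∧ (minpoly ℚ ev).natDegree = k))

/-- `SectorClause[S, hS]`: the cycle-induced sector clause (Varesco's normal form; VERBATIM the consequent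
of `CMThird.picardThreeK3Squares_of_realMultiplicationThird`). Local notation only. -/
local notation3 (prettyPrint := false) "SectorClause[" S ", " hS "]" =>
  (∀ (f : complexBetti S (2 * 1) →ₗ[ℂ] complexBetti S (2 * 1)),
    (∀ y, IsRationalClass y → IsRationalClass (f y)) →
    (∀ (i j : ℕ) y, IsOfHodgeType 2 S (2 * 1) i j y → IsOfHodgeType 2 S (2 * 1) i j (f y)) →
    (∀ d ∈ algebraicClasses S 1, f d = 0) →
    (∀ y : complexBetti S (2 * 1), ∀ d ∈ algebraicClasses S 1,
      cupProduct (rfl : 2 * 1 + 2 * 1 = 2 * 2) (f y) d = 0) →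
    ∃ g : complexBetti S (2 * 1) →ₗ[ℂ] complexBetti S (2 * 1),
      (∀ d ∈ algebraicClasses S 1, g d ∈ algebraicClasses S 1) ∧
      (∃ γ ∈ algebraicClasses (S ⊗ S) 2, ∀ y : complexBetti S (2 * 1),
        g y = Corr[complexOrientationFamily, IsK3Surface.isSmoothProjective hS ; γ, y]) ∧
      ∀ y : complexBetti S (2 * 1), Transc[S, y] → f y = g y)

/-! ### The packaged per-surface statement -/

/-- **HC⁴(S × S) for a marked projective K3 surface with a real-quadratic generator, granted Kuga–Satake
for `S`** (`QuadGen[S]` unpacked into `hodgeConjectureFor_square_of_selfSimilitude_generator_of_kugaSatake`).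
CONDITIONAL (Kuga–Satake hypothesis; fact Varesco2023). [cite: Varesco2023, Thm. 5.3 and Conj. 4.2]
[cite: GeemenSchutt2023, §2.1 and §4.8] -/
theorem hodgeConjectureFor_square_of_quadraticGenerator_of_kugaSatake
    (hVar : Varesco2023_transcendentalHodgeSimilitude_algebraic_of_kugaSatake_K3)
    (hS : IsK3Surface S) (hM : MarkedK3[S, η, p, x])
    (hKS : IsKSCorrespondenceAlgebraicBetti hS.isSmoothProjective) (hQ : QuadGen[S]) :
    HodgeConjectureFor 4 (S ⊗ S) := by
  obtain ⟨ψ, d, hd, h1, h2, h3, h4, h5, hψψ, hgen⟩ := hQ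
  exact hodgeConjectureFor_square_of_selfSimilitude_generator_of_kugaSatake hVar hS hM hKS ψ h1 h2 h3 h4 h5 d
    hd hψψ hgen

/-! ### The crux by name: modulo Kuga–Satake on the quadratic surfaces, the residue is RM of degree `≥ 3` -/

/-- **`PicardThreeK3Squares` BY NAME, the real-quadratic RM surfaces discharged modulo Kuga–Satake.**
Granted Buskin's Thm. 1.1, markings, Varesco's Thm. 5.3, and the Kuga–Satake statement
(`IsKSCorrespondenceAlgebraicBetti`) for every non-CM projective K3 surface with `3 ≤ ρ(S) ≤ 16` carrying
a real-quadratic generator (`QuadGen[S]`), the crux follows from the one-cycle clause of gen 8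
(`OneCycleOfDegree[S, hS]`: ONE algebraic self-correspondence whose `(2,0)`-eigenvalue has admissible
degree) on the non-CM, non-scalar projective K3 surfaces with `3 ≤ ρ(S) ≤ 16` and NO real-quadratic
generator — the surfaces whose `E(S)` is totally real of degree `≥ 3`. Proof: on a `QuadGen` surface
HC⁴(S × S) holds by `hodgeConjectureFor_square_of_quadraticGenerator_of_kugaSatake` (marking from
`Huybrechts_K3_marking_exists`), hence the sector clause
(`SectorIff.cycleInducedSector_of_hodgeConjectureFor_square`); elsewhere as in
`OneCycle.picardThreeK3Squares_of_oneCycleThird`; assembled by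
`HighPicard.picardThreeK3Squares_of_realMultiplicationThird_le_sixteen`. CONDITIONAL; credits nothing to HC.
[cite: Varesco2023, Thm. 5.3, Conj. 4.2 and §2 (p. 8)] [cite: GeemenSchutt2023, §4.8 and Rem. 4.9]
[cite: Vangeemen2008, Lemma 3.2] [cite: Buskin2019, Thm. 1.1] -/
theorem picardThreeK3Squares_of_kugaSatake_of_oneCycle_off_quadratic (hB : Buskin2019_hodgeIsometry_algebraic)
    (hmark : Huybrechts_K3_marking_exists)
    (hVar : Varesco2023_transcendentalHodgeSimilitude_algebraic_of_kugaSatake_K3)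
    (hKS : ∀ (S : SchemeOver ℂ) (hS : IsK3Surface S), ¬ HasComplexMultiplication S →
      3 ≤ Module.finrank ℂ ↥(algebraicClasses S 1) → Module.finrank ℂ ↥(algebraicClasses S 1) ≤ 16 →
      QuadGen[S] → IsKSCorrespondenceAlgebraicBetti hS.isSmoothProjective)
    (hOne : ∀ (S : SchemeOver ℂ) (hS : IsK3Surface S), ¬ HasComplexMultiplication S →
      3 ≤ Module.finrank ℂ ↥(algebraicClasses S 1) → Module.finrank ℂ ↥(algebraicClasses S 1) ≤ 16 →
      ¬ Scalar[S] → ¬ QuadGen[S] → OneCycleOfDegree[S, hS]) :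
    PicardThreeK3Squares := by
  refine HighPicard.picardThreeK3Squares_of_realMultiplicationThird_le_sixteen hB hmark
    fun S hS hCM h3 h16 hQ ↦ SectorIff.cycleInducedSector_of_hodgeConjectureFor_square
      complexOrientationFamily hS.isSmoothProjective ?_
  by_cases hq : QuadGen[S]
  · obtain ⟨η, p, x, hM⟩ := hmark S hS
    exact hodgeConjectureFor_square_of_quadraticGenerator_of_kugaSatake hVar hS hM (hKS S hS hCM h3 h16 hq) hq
  · obtain ⟨k, e, hk, hrat, htyp, hcyc, hev⟩ := hOne S hS hCM h3 h16 hQ hq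
    exact OneCycle.hodgeConjectureFor_square_of_oneCycle_natDegree hmark hS hk hCM complexOrientationFamily e hrat
      htyp hcyc hev

/-- **`PicardThreeK3Squares` BY NAME from the cycle-induced SECTOR CLAUSE off the real-quadratic surfaces,
modulo Kuga–Satake there** — the companion in Varesco's normal form (as
`CMThird.picardThreeK3Squares_of_realMultiplicationThird`), at every `ρ(S) ≥ 3`: granted Buskin, markings,
Varesco's Thm. 5.3 and the Kuga–Satake statement for the non-CM projective K3 surfaces with `ρ(S) ≥ 3`
and a real-quadratic generator, the crux follows from the sector clause on the non-CM, non-scalar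
projective K3 surfaces with `ρ(S) ≥ 3` and NO real-quadratic generator. Trichotomy by logic, plus the new
branch. CONDITIONAL; credits nothing to HC. [cite: Varesco2023, Thm. 5.3 and §2 (p. 8)]
[cite: Zarhin1983HodgeGroupsK3, Thm. 1.5.1] [cite: Buskin2019, Thm. 1.1] -/
theorem picardThreeK3Squares_of_kugaSatake_of_realMultiplicationThird_off_quadratic
    (hB : Buskin2019_hodgeIsometry_algebraic) (hmark : Huybrechts_K3_marking_exists)
    (hVar : Varesco2023_transcendentalHodgeSimilitude_algebraic_of_kugaSatake_K3)
    (hKS : ∀ (S : SchemeOver ℂ) (hS : IsK3Surface S), ¬ HasComplexMultiplication S →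
      3 ≤ Module.finrank ℂ ↥(algebraicClasses S 1) → QuadGen[S] →
      IsKSCorrespondenceAlgebraicBetti hS.isSmoothProjective)
    (hRM : ∀ (S : SchemeOver ℂ) (hS : IsK3Surface S), ¬ HasComplexMultiplication S →
      3 ≤ Module.finrank ℂ ↥(algebraicClasses S 1) → ¬ Scalar[S] → ¬ QuadGen[S] → SectorClause[S, hS]) :
    PicardThreeK3Squares := by
  intro S hS η p x hM hρ
  by_cases hCM : HasComplexMultiplication S
  · exact CMThird.hodgeConjectureFor_square_of_CM_of_buskin hB hmark S hS hCM
  · by_cases hQ : Scalar[S]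
    · exact SquareGlueFree.hodgeConjectureFor_square_of_hodgeEndomorphisms_scalar hS.isSmoothProjective hQ
    · by_cases hq : QuadGen[S]
      · exact hodgeConjectureFor_square_of_quadraticGenerator_of_kugaSatake hVar hS hM (hKS S hS hCM hρ hq) hq
      · exact CycleInducedSector.hodgeConjectureFor_square_of_cycleInducedSector complexOrientationFamily
          hS.isSmoothProjective (hRM S hS hCM hρ hQ hq)

end Summit.HodgeConjecture.HodgeConjecture.Theorems.MarkmanPartnerTransport.KugaSatakeSimilitude

end
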